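import Summits.ValiantsHypothesis.ValiantsHypothesis.Theorems.KPlusLogSqLawTropicalBTwoBoundaryQuadratic
import Summits.ValiantsHypothesis.ValiantsHypothesis.Theorems.KPlusLogSqLawTropicalBBoundarySectorSharp
import Summits.ValiantsHypothesis.ValiantsHypothesis.Theorems.KPlusLogSqLawTropicalBBoundarySectorCounting

/-!
# Route «KPlusLogSqLaw», crux `TropicalB` (stmt-ValiantsHypothesis-19771) — the port's boundary pair is EXACTLY quadratic:
# every dense design on the pair (identity, half-swap) has at most `(M+1)²` dominant terms, whatever the labelling

HONEST FRAMING.  Proof file (pure theorems), seat val-sym-trop-p1 g17 (cell `pub-symmetroid`, 2026-08-28), `--supports stmt-ValiantsHypothesis-19771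
--as helper`, toward the registered stubs `stub_tropThin` / `stub_tropFat` of `Cruxes/TropicalB/Lines/birth.lean` (crux `TropicalB`).  A COUNTING law
complementing `TwoPort.not_boundaryVertexLaw_two_one` (p618781): for the boundary pair `bd` of the two-boundary port (key pair 0 = identity, key
pair 1 = `finAddFlip` on both sides of `Fin (m+m)`) the four patterns sit on the four blocks — real/real and partner/partner cells read `(w, w)`
(`w` the wrap bit), (partner row, real column) reads `(0,1)`, (real row, partner column) reads `(1,0)` — so in every perfect matching the number of
`(0,1)` cells equals the number of `(1,0)` cells (`card_FT_eq_card_TF`: both count the columns that leave their half), the pattern-count vector is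
determined by two of its entries, and slope counting gives

* `designRowD_halfSwap` — every dense boundary-type design on this pair, for EVERY labelling `lab : (Fin 2 → Bool) → Fin K`, all exponents and
  valuations, has unsigned row bound `(M+1)² − 1` (`M = 2m`); `card_dominant_halfSwap_le` — at most `(M+1)²` dominant terms.
Together with `TwoPort.T_le_card_dominant` (≥ `C(m+2,2) − 1` on the same pair): the pair is EXACTLY quadratic, so the content of the cell's target
`BoundaryVertexLaw 2 2` lies in boundary pairs whose `(0,1)`- and `(1,0)`-counts are NOT tied (e.g. identity × row-reversal).
Nothing here bounds `TropicalB` in its window; nothing bears on `WeakLifting`, DoorA26 / DoorA34, `MatrixDescartes` (stmt-ValiantsHypothesis-18050)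
or VP ≠ VNP.
-/

set_option linter.dupNamespace false
set_option autoImplicit false

namespace Summit.ValiantsHypothesis.ValiantsHypothesis.Theorems.KPlusLogSqLaw

namespace BoundarySector

namespace TwoPort

open Summit.ValiantsHypothesis.ValiantsHypothesis.Theorems.MatrixDescartes.Negative
open Summit.ValiantsHypothesis.ValiantsHypothesis.Theorems.LacunarySymmetroidMatrixDescartes
open Finset

variable (n : ℕ)

/-! ### 1. The patterns of the four blocks -/

/-- bit `0` of a cell: the plain order on `Fin (m+m)`. -/
theorem bit_zero (x y : Fin ((n + 1) + (n + 1))) : pattern (bd n) (bd n) x y 0 = decide (x < y) := by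
  unfold pattern; rw [bd_zero]; rfl

/-- bit `1` of a cell: the order after swapping the halves. -/
theorem bit_one (x y : Fin ((n + 1) + (n + 1))) : pattern (bd n) (bd n) x y 1 = decide (finAddFlip x < finAddFlip y) := by
  unfold pattern; rw [bd_one]

/-- on a real/real cell the two bits agree. -/
theorem bits_rr (a b : Fin (n + 1)) :
    pattern (bd n) (bd n) (Fin.castAdd (n + 1) a) (Fin.castAdd (n + 1) b) 0 =
      pattern (bd n) (bd n) (Fin.castAdd (n + 1) a) (Fin.castAdd (n + 1) b) 1 := by
  rw [bit_zero, bit_one, flip_RE, flip_RE]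
  have e1 : ((Fin.castAdd (n + 1) a : Fin ((n + 1) + (n + 1))) < Fin.castAdd (n + 1) b) ↔ (a : ℕ) < (b : ℕ) := by
    rw [Fin.lt_def, val_RE, val_RE]
  have e2 : ((Fin.natAdd (n + 1) a : Fin ((n + 1) + (n + 1))) < Fin.natAdd (n + 1) b) ↔ (a : ℕ) < (b : ℕ) := by
    rw [Fin.lt_def, val_PA, val_PA]; omega
  simp only [e1, e2]

/-- on a partner/partner cell the two bits agree. -/
theorem bits_pp (b' c : Fin (n + 1)) :
    pattern (bd n) (bd n) (Fin.natAdd (n + 1) b') (Fin.natAdd (n + 1) c) 0 =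
      pattern (bd n) (bd n) (Fin.natAdd (n + 1) b') (Fin.natAdd (n + 1) c) 1 := by
  rw [bit_zero, bit_one, flip_PA, flip_PA]
  have e1 : ((Fin.natAdd (n + 1) b' : Fin ((n + 1) + (n + 1))) < Fin.natAdd (n + 1) c) ↔ (b' : ℕ) < (c : ℕ) := by
    rw [Fin.lt_def, val_PA, val_PA]; omega
  have e2 : ((Fin.castAdd (n + 1) b' : Fin ((n + 1) + (n + 1))) < Fin.castAdd (n + 1) c) ↔ (b' : ℕ) < (c : ℕ) := by
    rw [Fin.lt_def, val_RE, val_RE]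
  simp only [e1, e2]

/-- a (partner row, real column) cell reads `(0,1)`. -/
theorem bits_pr (b' b : Fin (n + 1)) :
    pattern (bd n) (bd n) (Fin.natAdd (n + 1) b') (Fin.castAdd (n + 1) b) 0 = false ∧
      pattern (bd n) (bd n) (Fin.natAdd (n + 1) b') (Fin.castAdd (n + 1) b) 1 = true := by
  rw [bit_zero, bit_one, flip_PA, flip_RE]
  have e1 : ¬ ((Fin.natAdd (n + 1) b' : Fin ((n + 1) + (n + 1))) < Fin.castAdd (n + 1) b) := by
    rw [Fin.lt_def, val_PA, val_RE]; omega
  have e2 : ((Fin.castAdd (n + 1) b' : Fin ((n + 1) + (n + 1))) < Fin.natAdd (n + 1) b) := by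
    rw [Fin.lt_def, val_RE, val_PA]; omega
  exact ⟨decide_eq_false e1, decide_eq_true e2⟩

/-- a (real row, partner column) cell reads `(1,0)`. -/
theorem bits_rp (a c : Fin (n + 1)) :
    pattern (bd n) (bd n) (Fin.castAdd (n + 1) a) (Fin.natAdd (n + 1) c) 0 = true ∧
      pattern (bd n) (bd n) (Fin.castAdd (n + 1) a) (Fin.natAdd (n + 1) c) 1 = false := by
  rw [bit_zero, bit_one, flip_RE, flip_PA]
  have e1 : ((Fin.castAdd (n + 1) a : Fin ((n + 1) + (n + 1))) < Fin.natAdd (n + 1) c) := by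
    rw [Fin.lt_def, val_RE, val_PA]; omega
  have e2 : ¬ ((Fin.natAdd (n + 1) a : Fin ((n + 1) + (n + 1))) < Fin.castAdd (n + 1) c) := by
    rw [Fin.lt_def, val_PA, val_RE]; omega
  exact ⟨decide_eq_true e1, decide_eq_false e2⟩

/-! ### 2. The `(0,1)`-cells and `(1,0)`-cells of a perfect matching are equinumerous -/

/-- a cell reads `(0,1)` iff it is a (partner row, real column) cell. -/
theorem pattern_FT_iff (σ : Equiv.Perm (Fin ((n + 1) + (n + 1)))) (y : Fin ((n + 1) + (n + 1))) :
    (pattern (bd n) (bd n) (σ y) y 0 = false ∧ pattern (bd n) (bd n) (σ y) y 1 = true) ↔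
      ((y : ℕ) < n + 1 ∧ ¬ ((σ y : Fin _) : ℕ) < n + 1) := by
  rcases re_or_pa n y with ⟨b, rfl⟩ | ⟨b, rfl⟩ <;> rcases re_or_pa n (σ _) with ⟨a, ha⟩ | ⟨a, ha⟩ <;> rw [ha]
  · refine iff_of_false ?_ ?_
    · rintro ⟨h0, h1⟩; rw [bits_rr] at h0; exact Bool.false_ne_true (h0.symm.trans h1)
    · rintro ⟨_, h2⟩; exact h2 (by rw [val_RE]; exact a.isLt)
  · exact iff_of_true (bits_pr n a b) ⟨by rw [val_RE]; exact b.isLt, by rw [val_PA]; omega⟩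
  · refine iff_of_false ?_ ?_
    · rintro ⟨h0, _⟩; exact Bool.false_ne_true (h0.symm.trans (bits_rp n a b).1)
    · rintro ⟨h1, _⟩; rw [val_PA] at h1; omega
  · refine iff_of_false ?_ ?_
    · rintro ⟨h0, h1⟩; rw [bits_pp] at h0; exact Bool.false_ne_true (h0.symm.trans h1)
    · rintro ⟨h1, _⟩; rw [val_PA] at h1; omega

/-- a cell reads `(1,0)` iff it is a (real row, partner column) cell. -/
theorem pattern_TF_iff (σ : Equiv.Perm (Fin ((n + 1) + (n + 1)))) (y : Fin ((n + 1) + (n + 1))) :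
    (pattern (bd n) (bd n) (σ y) y 0 = true ∧ pattern (bd n) (bd n) (σ y) y 1 = false) ↔
      (¬ (y : ℕ) < n + 1 ∧ ((σ y : Fin _) : ℕ) < n + 1) := by
  rcases re_or_pa n y with ⟨b, rfl⟩ | ⟨b, rfl⟩ <;> rcases re_or_pa n (σ _) with ⟨a, ha⟩ | ⟨a, ha⟩ <;> rw [ha]
  · refine iff_of_false ?_ ?_
    · rintro ⟨h0, h1⟩; rw [bits_rr] at h0; exact Bool.false_ne_true (h1.symm.trans h0)
    · rintro ⟨h1, _⟩; exact h1 (by rw [val_RE]; exact b.isLt)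
  · refine iff_of_false ?_ ?_
    · rintro ⟨h0, _⟩; exact Bool.false_ne_true ((bits_pr n a b).1.symm.trans h0)
    · rintro ⟨h1, _⟩; exact h1 (by rw [val_RE]; exact b.isLt)
  · exact iff_of_true (bits_rp n a b) ⟨by rw [val_PA]; omega, by rw [val_RE]; exact a.isLt⟩
  · refine iff_of_false ?_ ?_
    · rintro ⟨h0, h1⟩; rw [bits_pp] at h0; exact Bool.false_ne_true (h1.symm.trans h0)
    · rintro ⟨_, h2⟩; rw [val_PA] at h2; omega

/-- **leavers equal arrivals**: as many real columns sit on partner rows as partner columns sit on real rows. -/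
theorem card_leave_eq (σ : Equiv.Perm (Fin ((n + 1) + (n + 1)))) :
    (univ.filter fun y : Fin ((n + 1) + (n + 1)) => (y : ℕ) < n + 1 ∧ ¬ ((σ y : Fin _) : ℕ) < n + 1).card =
      (univ.filter fun y : Fin ((n + 1) + (n + 1)) => ¬ (y : ℕ) < n + 1 ∧ ((σ y : Fin _) : ℕ) < n + 1).card := by
  classical
  -- #{y real} = #{y : σ y real} (σ is a bijection)
  have h1 : (univ.filter fun y : Fin ((n + 1) + (n + 1)) => ((σ y : Fin _) : ℕ) < n + 1).card =
      (univ.filter fun y : Fin ((n + 1) + (n + 1)) => (y : ℕ) < n + 1).card := by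
    refine Finset.card_bij (fun y _ => σ y) (fun y hy => ?_) (fun y _ y' _ h => σ.injective h) (fun x hx => ?_)
    · rw [mem_filter] at hy ⊢; exact ⟨mem_univ _, hy.2⟩
    · refine ⟨σ.symm x, ?_, σ.apply_symm_apply x⟩
      rw [mem_filter] at hx ⊢; exact ⟨mem_univ _, by rw [σ.apply_symm_apply]; exact hx.2⟩
  -- split both sets by the other predicate
  have h2 := Finset.card_filter_add_card_filter_not
    (s := univ.filter fun y : Fin ((n + 1) + (n + 1)) => (y : ℕ) < n + 1) (fun y => ((σ y : Fin _) : ℕ) < n + 1)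
  have h3 := Finset.card_filter_add_card_filter_not
    (s := univ.filter fun y : Fin ((n + 1) + (n + 1)) => ((σ y : Fin _) : ℕ) < n + 1) (fun y => (y : ℕ) < n + 1)
  rw [filter_filter, filter_filter] at h2 h3
  have h4 : (univ.filter fun y : Fin ((n + 1) + (n + 1)) => (y : ℕ) < n + 1 ∧ ((σ y : Fin _) : ℕ) < n + 1) =
      (univ.filter fun y : Fin ((n + 1) + (n + 1)) => ((σ y : Fin _) : ℕ) < n + 1 ∧ (y : ℕ) < n + 1) :=
    filter_congr fun y _ => and_comm
  have h5 : (univ.filter fun y : Fin ((n + 1) + (n + 1)) => ((σ y : Fin _) : ℕ) < n + 1 ∧ ¬ (y : ℕ) < n + 1) =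
      (univ.filter fun y : Fin ((n + 1) + (n + 1)) => ¬ (y : ℕ) < n + 1 ∧ ((σ y : Fin _) : ℕ) < n + 1) :=
    filter_congr fun y _ => and_comm
  rw [h4] at h2
  rw [h5] at h3
  omega

/-- **the `(0,1)`-count equals the `(1,0)`-count** for every permutation. -/
theorem card_FT_eq_card_TF (σ : Equiv.Perm (Fin ((n + 1) + (n + 1)))) :
    (univ.filter fun y : Fin ((n + 1) + (n + 1)) => pattern (bd n) (bd n) (σ y) y = ![false, true]).card =
      (univ.filter fun y : Fin ((n + 1) + (n + 1)) => pattern (bd n) (bd n) (σ y) y = ![true, false]).card := by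
  have eFT : ∀ y, pattern (bd n) (bd n) (σ y) y = ![false, true] ↔
      ((y : ℕ) < n + 1 ∧ ¬ ((σ y : Fin _) : ℕ) < n + 1) := fun y => by
    rw [← pattern_FT_iff]
    constructor
    · intro h; exact ⟨by rw [h]; rfl, by rw [h]; rfl⟩
    · rintro ⟨h0, h1⟩
      funext j
      fin_cases j
      · simpa using h0
      · simpa using h1
  have eTF : ∀ y, pattern (bd n) (bd n) (σ y) y = ![true, false] ↔
      (¬ (y : ℕ) < n + 1 ∧ ((σ y : Fin _) : ℕ) < n + 1) := fun y => by
    rw [← pattern_TF_iff]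
    constructor
    · intro h; exact ⟨by rw [h]; rfl, by rw [h]; rfl⟩
    · rintro ⟨h0, h1⟩
      funext j
      fin_cases j
      · simpa using h0
      · simpa using h1
  rw [filter_congr fun y _ => eFT y, filter_congr fun y _ => eTF y]
  exact card_leave_eq n σ

/-! ### 3. Slope counting with two free pattern counts -/

/-- a four-term expansion of a sum over `Fin 2 → Bool`. -/
theorem sum_fin_two_bool (f : (Fin 2 → Bool) → ℤ) :
    ∑ P : Fin 2 → Bool, f P = f ![true, true] + f ![true, false] + f ![false, true] + f ![false, false] := by
  rw [← Equiv.sum_comp (finTwoArrowEquiv Bool).symm f, Fintype.sum_prod_type]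
  simp only [Fintype.sum_bool, finTwoArrowEquiv_symm_apply]
  ring

variable {n}

/-- **The port's boundary pair is at most quadratic, for every labelling**: unsigned row bound `(M+1)² − 1`, `M = 2m`. -/
theorem designRowD_halfSwap {K : ℕ} (lab : (Fin 2 → Bool) → Fin K) (d : Fin K → ℕ)
    (v ε : Fin ((n + 1) + (n + 1)) → Fin ((n + 1) + (n + 1)) → Fin K → ℤ) (hε : IsBoundaryDesign (bd n) (bd n) lab ε) :
    DesignRowD d v ε ((((n + 1) + (n + 1)) + 1) ^ 2 - 1) := by
  classical
  intro N θ p hθ hdom hne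
  have hsm := slope_strictMono_of_chainD d v ε θ p hθ hdom hne
  let cnt : Fin (N + 1) → (Fin 2 → Bool) → ℕ := fun k P =>
    (univ.filter fun y : Fin ((n + 1) + (n + 1)) => pattern (bd n) (bd n) ((p k).1 y) y = P).card
  have hcle : ∀ k P, cnt k P < ((n + 1) + (n + 1)) + 1 := fun k P =>
    Nat.lt_succ_of_le ((card_filter_le _ _).trans (by rw [card_univ, Fintype.card_fin]))
  have hsum : ∀ k, ((cnt k ![true, true] : ℕ) : ℤ) + cnt k ![true, false] + cnt k ![false, true] + cnt k ![false, false] =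
      (((n + 1) + (n + 1) : ℕ) : ℤ) := by
    intro k
    have h := congrArg (Nat.cast : ℕ → ℤ) (sum_patternCount (bd n) (bd n) (p k).1)
    rw [Nat.cast_sum, sum_fin_two_bool] at h
    exact h
  have htf : ∀ k, cnt k ![false, true] = cnt k ![true, false] := fun k => card_FT_eq_card_TF n (p k).1
  let key : Fin (N + 1) → Fin (((n + 1) + (n + 1)) + 1) × Fin (((n + 1) + (n + 1)) + 1) := fun k =>
    (⟨cnt k ![false, true], hcle k _⟩, ⟨cnt k ![true, true], hcle k _⟩)
  have hinj : Function.Injective key := by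
    intro k k' h
    have h1 : cnt k ![false, true] = cnt k' ![false, true] :=
      congrArg (fun x => ((x.1 : Fin (((n + 1) + (n + 1)) + 1)) : ℕ)) h
    have h2 : cnt k ![true, true] = cnt k' ![true, true] :=
      congrArg (fun x => ((x.2 : Fin (((n + 1) + (n + 1)) + 1)) : ℕ)) h
    have h3 : cnt k ![true, false] = cnt k' ![true, false] := by rw [← htf, ← htf, h1]
    have h4 : ((cnt k ![false, false] : ℕ) : ℤ) = cnt k' ![false, false] := by
      have e1 := hsum k; have e2 := hsum k'
      rw [h1, h2, h3] at e1
      linarith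
    apply hsm.injective
    show TropicalCensus.slope d (p k) = TropicalCensus.slope d (p k')
    rw [slope_eq_sum_patternCount d hε (hdom k).1, slope_eq_sum_patternCount d hε (hdom k').1,
      sum_fin_two_bool, sum_fin_two_bool]
    change ((cnt k ![true, true] : ℕ) : ℤ) * _ + ((cnt k ![true, false] : ℕ) : ℤ) * _ +
        ((cnt k ![false, true] : ℕ) : ℤ) * _ + ((cnt k ![false, false] : ℕ) : ℤ) * _ =
      ((cnt k' ![true, true] : ℕ) : ℤ) * _ + ((cnt k' ![true, false] : ℕ) : ℤ) * _ +
        ((cnt k' ![false, true] : ℕ) : ℤ) * _ + ((cnt k' ![false, false] : ℕ) : ℤ) * _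
    rw [h1, h2, h3, h4]
  have hcard := Fintype.card_le_of_injective key hinj
  rw [Fintype.card_fin, Fintype.card_prod, Fintype.card_fin] at hcard
  have hpos : 1 ≤ (((n + 1) + (n + 1)) + 1) ^ 2 := Nat.one_le_pow _ _ (Nat.succ_pos _)
  rw [sq] at hpos ⊢
  omega

open scoped Classical in
/-- **At most `(M+1)²` dominant terms on the port's boundary pair**, for every labelling, exponents and valuations. -/
theorem card_dominant_halfSwap_le {K : ℕ} (lab : (Fin 2 → Bool) → Fin K) (d : Fin K → ℕ)
    (v ε : Fin ((n + 1) + (n + 1)) → Fin ((n + 1) + (n + 1)) → Fin K → ℤ) (hε : IsBoundaryDesign (bd n) (bd n) lab ε) :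
    (univ.filter fun q : Equiv.Perm (Fin ((n + 1) + (n + 1))) × (Fin ((n + 1) + (n + 1)) → Fin K) =>
      ∃ t : ℤ, IsDominant d v ε t q).card ≤ (((n + 1) + (n + 1)) + 1) ^ 2 := by
  have h := card_dominant_le_succ d v ε (designRowD_halfSwap lab d v ε hε)
  have hpos : 1 ≤ (((n + 1) + (n + 1)) + 1) ^ 2 := Nat.one_le_pow _ _ (Nat.succ_pos _)
  omega

open scoped Classical in
/-- **The port's boundary pair is EXACTLY quadratic**: the port design reaches `C(m+2,2) − 1` dominant terms and no design on the pair exceeds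
`(M+1)²`. -/
theorem halfSwap_exactlyQuadratic (n : ℕ) :
    (n + 3).choose 2 - 1 ≤ (univ.filter fun q : Equiv.Perm (Fin ((n + 1) + (n + 1))) × (Fin ((n + 1) + (n + 1)) → Fin 3) =>
        ∃ t : ℤ, IsDominant (TropicalCensus.ShiftThree.dd n) (bigV n) (bigE n) t q).card ∧
    (∀ {K : ℕ} (lab : (Fin 2 → Bool) → Fin K) (d : Fin K → ℕ)
      (v ε : Fin ((n + 1) + (n + 1)) → Fin ((n + 1) + (n + 1)) → Fin K → ℤ), IsBoundaryDesign (bd n) (bd n) lab ε →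
      (univ.filter fun q : Equiv.Perm (Fin ((n + 1) + (n + 1))) × (Fin ((n + 1) + (n + 1)) → Fin K) =>
        ∃ t : ℤ, IsDominant d v ε t q).card ≤ (((n + 1) + (n + 1)) + 1) ^ 2) := by
  refine ⟨?_, fun lab d v ε hε => card_dominant_halfSwap_le lab d v ε hε⟩
  have h1 := T_le_card_dominant (n := n)
  have h2 := TropicalCensus.ShiftThree.T_last n
  omega

end TwoPort

end BoundarySector

end Summit.ValiantsHypothesis.ValiantsHypothesis.Theorems.KPlusLogSqLaw
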